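import Mathlib

/-!
# Gaussian averages of measures as superpositions of balls (helper for `ParityRigidity`)

Layer-cake representation of the Gaussian average `∫ e^{-‖x-z‖²/s} dν(z)` of a measure `ν` on a
real normed space: its super-level sets are closed balls, whence two-sided bounds of the average by
integrals of `ν (closedBall x r)` over radii `r < δ` plus a Gaussian tail `e^{-δ²/s} ν(F)`, a lower
bound `e⁻¹ ν (closedBall x √s)`, and the negligibility of the tail against polynomial ball masses as
`s → 0⁺`.  Used by `JParityClosureParityRigidityGaussDiff` (Gaussian relative differentiation).

Helper file for item stmt-AtomisticToContinuum-13084 (route JParityClosure, decl `ParityRigidity`).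
-/

open MeasureTheory Metric Real Filter Topology Set
open scoped ENNReal NNReal Topology

namespace Summit.AtomisticToContinuum.HydrodynamicLimit.Theorems.ParityRigidity

variable {F : Type*} [NormedAddCommGroup F]

/-- Super-level sets of the Gaussian kernel `z ↦ exp (-‖x - z‖² / s)` at levels `t ∈ (0, 1]` are
the closed balls `closedBall x √(s log t⁻¹)`. -/
theorem setOf_le_exp_neg_norm_sq_div (x : F) {s t : ℝ} (hs : 0 < s) (ht0 : 0 < t) (ht1 : t ≤ 1) :
    {z : F | t ≤ Real.exp (-‖x - z‖ ^ 2 / s)} = closedBall x (Real.sqrt (s * Real.log t⁻¹)) := by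
  have hlog : 0 ≤ Real.log t⁻¹ := Real.log_nonneg ((one_le_inv₀ ht0).2 ht1)
  have hw : 0 ≤ s * Real.log t⁻¹ := mul_nonneg hs.le hlog
  ext z
  simp only [mem_setOf_eq, mem_closedBall, dist_comm z x, dist_eq_norm]
  rw [← Real.log_le_iff_le_exp ht0]
  have key : Real.log t ≤ -‖x - z‖ ^ 2 / s ↔ ‖x - z‖ ^ 2 ≤ s * Real.log t⁻¹ := by
    rw [Real.log_inv, neg_div, le_neg, div_le_iff₀ hs]
    constructor <;> intro h <;> nlinarith [h]
  rw [key]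
  constructor
  · intro h
    calc ‖x - z‖ = Real.sqrt (‖x - z‖ ^ 2) := (Real.sqrt_sq (norm_nonneg _)).symm
      _ ≤ Real.sqrt (s * Real.log t⁻¹) := Real.sqrt_le_sqrt h
  · intro h
    calc ‖x - z‖ ^ 2 ≤ (Real.sqrt (s * Real.log t⁻¹)) ^ 2 := by gcongr
      _ = s * Real.log t⁻¹ := Real.sq_sqrt hw

/-- Super-level sets of the Gaussian kernel at levels `t > 1` are empty. -/
theorem setOf_le_exp_neg_norm_sq_div_eq_empty (x : F) {s t : ℝ} (hs : 0 < s) (ht : 1 < t) :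
    {z : F | t ≤ Real.exp (-‖x - z‖ ^ 2 / s)} = ∅ := by
  ext z
  simp only [mem_setOf_eq, mem_empty_iff_false, iff_false, not_le]
  refine lt_of_le_of_lt ?_ ht
  rw [← Real.exp_zero]
  refine Real.exp_le_exp.2 ?_
  rw [neg_div, neg_nonpos]
  positivity

/-- For levels `t ∈ (e^{-δ²/s}, 1)` the radius `√(s log t⁻¹)` lies in `(0, δ)`. -/
theorem sqrt_mul_log_inv_mem_Ioo {s δ t : ℝ} (hs : 0 < s) (hδ : 0 < δ)
    (ht : t ∈ Ioo (Real.exp (-δ ^ 2 / s)) 1) :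
    Real.sqrt (s * Real.log t⁻¹) ∈ Ioo 0 δ := by
  obtain ⟨ht1, ht2⟩ := ht
  have ht0 : 0 < t := (Real.exp_pos _).trans ht1
  have hlog : 0 < Real.log t⁻¹ := Real.log_pos ((one_lt_inv₀ ht0).2 ht2)
  refine ⟨Real.sqrt_pos.2 (mul_pos hs hlog), ?_⟩
  rw [Real.sqrt_lt' hδ]
  have h1 : Real.log t⁻¹ < δ ^ 2 / s := by
    rw [Real.log_inv, neg_lt, ← Real.exp_lt_exp, Real.exp_log ht0]
    simpa [neg_div] using ht1
  calc s * Real.log t⁻¹ < s * (δ ^ 2 / s) := mul_lt_mul_of_pos_left h1 hs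
    _ = δ ^ 2 := by field_simp

variable [MeasurableSpace F] [BorelSpace F]

/-- Layer-cake formula for the Gaussian average of a measure. -/
theorem lintegral_exp_neg_norm_sq_div_eq (ν : Measure F) (x : F) (s : ℝ) :
    ∫⁻ z, ENNReal.ofReal (Real.exp (-‖x - z‖ ^ 2 / s)) ∂ν =
      ∫⁻ t in Ioi (0 : ℝ), ν {z : F | t ≤ Real.exp (-‖x - z‖ ^ 2 / s)} := by
  refine lintegral_eq_lintegral_meas_le ν (Eventually.of_forall fun z => (Real.exp_pos _).le) ?_
  have : Continuous fun z : F => Real.exp (-‖x - z‖ ^ 2 / s) := by fun_prop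
  exact this.measurable.aemeasurable

/-- Lower layer-cake bound: the levels `t ∈ (e^{-δ²/s}, 1)` contribute closed balls of radius
`< δ`. -/
theorem setLIntegral_Ioo_le_lintegral_exp (ν : Measure F) (x : F) {s δ : ℝ} (hs : 0 < s) :
    ∫⁻ t in Ioo (Real.exp (-δ ^ 2 / s)) 1, ν (closedBall x (Real.sqrt (s * Real.log t⁻¹))) ≤
      ∫⁻ z, ENNReal.ofReal (Real.exp (-‖x - z‖ ^ 2 / s)) ∂ν := by
  rw [lintegral_exp_neg_norm_sq_div_eq]
  calc ∫⁻ t in Ioo (Real.exp (-δ ^ 2 / s)) 1, ν (closedBall x (Real.sqrt (s * Real.log t⁻¹)))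
      = ∫⁻ t in Ioo (Real.exp (-δ ^ 2 / s)) 1, ν {z : F | t ≤ Real.exp (-‖x - z‖ ^ 2 / s)} := by
        refine setLIntegral_congr_fun measurableSet_Ioo (fun t ht => ?_)
        rw [setOf_le_exp_neg_norm_sq_div x hs ((Real.exp_pos _).trans ht.1) ht.2.le]
    _ ≤ ∫⁻ t in Ioi (0 : ℝ), ν {z : F | t ≤ Real.exp (-‖x - z‖ ^ 2 / s)} :=
        lintegral_mono_set (fun t ht => (Real.exp_pos _).trans ht.1)

/-- Upper layer-cake bound: beyond the levels `t ∈ (e^{-δ²/s}, 1)` only the Gaussian tail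
`e^{-δ²/s} ν(F)` remains. -/
theorem lintegral_exp_le_add_setLIntegral_Ioo (ν : Measure F) [IsFiniteMeasure ν] (x : F)
    {s δ : ℝ} (hs : 0 < s) :
    ∫⁻ z, ENNReal.ofReal (Real.exp (-‖x - z‖ ^ 2 / s)) ∂ν ≤
      ENNReal.ofReal (Real.exp (-δ ^ 2 / s)) * ν univ +
        ∫⁻ t in Ioo (Real.exp (-δ ^ 2 / s)) 1, ν (closedBall x (Real.sqrt (s * Real.log t⁻¹))) := by
  rw [lintegral_exp_neg_norm_sq_div_eq]
  set f : ℝ → ℝ≥0∞ := fun t => ν {z : F | t ≤ Real.exp (-‖x - z‖ ^ 2 / s)} with hf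
  set tδ : ℝ := Real.exp (-δ ^ 2 / s) with htδ
  have htδ0 : 0 < tδ := Real.exp_pos _
  have hsub : Ioi (0 : ℝ) ⊆ Ioc 0 tδ ∪ Ioo tδ 1 ∪ Ici 1 := by
    intro t ht
    rcases le_or_gt t tδ with h | h
    · exact Or.inl (Or.inl ⟨ht, h⟩)
    · rcases lt_or_ge t 1 with h' | h'
      · exact Or.inl (Or.inr ⟨h, h'⟩)
      · exact Or.inr h'
  have h1 : (∫⁻ t in Ioc 0 tδ, f t) ≤ ENNReal.ofReal tδ * ν univ := by
    calc (∫⁻ t in Ioc 0 tδ, f t) ≤ ∫⁻ _ in Ioc 0 tδ, ν univ :=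
          lintegral_mono fun t => measure_mono (subset_univ _)
      _ = ENNReal.ofReal tδ * ν univ := by
          rw [setLIntegral_const, Real.volume_Ioc, sub_zero, mul_comm]
  have h2 : (∫⁻ t in Ici 1, f t) = 0 := by
    rw [setLIntegral_congr (Ioi_ae_eq_Ici (a := (1 : ℝ)) (μ := volume)).symm]
    refine (setLIntegral_congr_fun measurableSet_Ioi (fun t ht => ?_)).trans lintegral_zero
    show f t = 0
    simp only [hf]
    rw [setOf_le_exp_neg_norm_sq_div_eq_empty x hs ht, measure_empty]
  have h3 : (∫⁻ t in Ioo tδ 1, f t) =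
      ∫⁻ t in Ioo tδ 1, ν (closedBall x (Real.sqrt (s * Real.log t⁻¹))) := by
    refine setLIntegral_congr_fun measurableSet_Ioo (fun t ht => ?_)
    simp only [hf]
    rw [setOf_le_exp_neg_norm_sq_div x hs (htδ0.trans ht.1) ht.2.le]
  calc (∫⁻ t in Ioi (0 : ℝ), f t) ≤ ∫⁻ t in Ioc 0 tδ ∪ Ioo tδ 1 ∪ Ici 1, f t :=
        lintegral_mono_set hsub
    _ ≤ (∫⁻ t in Ioc 0 tδ ∪ Ioo tδ 1, f t) + ∫⁻ t in Ici 1, f t := lintegral_union_le _ _ _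
    _ ≤ ((∫⁻ t in Ioc 0 tδ, f t) + ∫⁻ t in Ioo tδ 1, f t) + ∫⁻ t in Ici 1, f t :=
        add_le_add (lintegral_union_le _ _ _) le_rfl
    _ ≤ (ENNReal.ofReal tδ * ν univ + ∫⁻ t in Ioo tδ 1, f t) + 0 := by
        rw [h2]
        exact add_le_add (add_le_add h1 le_rfl) le_rfl
    _ = _ := by rw [add_zero, h3]

/-- Lower bound for the Gaussian average: the levels `t ∈ (0, e⁻¹]` see at least the closed ball of
radius `√s`. -/
theorem mul_measure_closedBall_sqrt_le_lintegral_exp (ν : Measure F) (x : F) {s : ℝ} (hs : 0 < s) :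
    ENNReal.ofReal (Real.exp (-1)) * ν (closedBall x (Real.sqrt s)) ≤
      ∫⁻ z, ENNReal.ofReal (Real.exp (-‖x - z‖ ^ 2 / s)) ∂ν := by
  rw [lintegral_exp_neg_norm_sq_div_eq]
  calc ENNReal.ofReal (Real.exp (-1)) * ν (closedBall x (Real.sqrt s))
      = ∫⁻ _ in Ioc (0 : ℝ) (Real.exp (-1)), ν (closedBall x (Real.sqrt s)) := by
        rw [setLIntegral_const, Real.volume_Ioc, sub_zero, mul_comm]
    _ ≤ ∫⁻ t in Ioc (0 : ℝ) (Real.exp (-1)), ν {z : F | t ≤ Real.exp (-‖x - z‖ ^ 2 / s)} := by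
        refine setLIntegral_mono' measurableSet_Ioc (fun t ht => measure_mono ?_)
        intro z hz
        simp only [mem_closedBall, dist_comm z x, dist_eq_norm] at hz
        simp only [mem_setOf_eq]
        refine ht.2.trans (Real.exp_le_exp.2 ?_)
        rw [neg_div, neg_le_neg_iff, div_le_one hs]
        calc ‖x - z‖ ^ 2 ≤ (Real.sqrt s) ^ 2 := by gcongr
          _ = s := Real.sq_sqrt hs.le
    _ ≤ _ := lintegral_mono_set (fun t ht => ht.1)


omit [BorelSpace F] in
/-- The Gaussian average of a finite measure is finite (the kernel is bounded by `1`). -/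
theorem lintegral_exp_neg_norm_sq_div_lt_top (ν : Measure F) [IsFiniteMeasure ν] (x : F) {s : ℝ}
    (hs : 0 < s) : ∫⁻ z, ENNReal.ofReal (Real.exp (-‖x - z‖ ^ 2 / s)) ∂ν < ⊤ := by
  refine lt_of_le_of_lt (lintegral_mono (g := fun _ => 1) fun z => ?_) ?_
  · rw [ENNReal.ofReal_le_one, ← Real.exp_zero]
    refine Real.exp_le_exp.2 ?_
    rw [neg_div, neg_nonpos]
    positivity
  · rw [lintegral_const, one_mul]
    exact measure_lt_top ν univ

/-- Gaussian tails are negligible against polynomial ball volumes: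
`e^{-δ²/s} / (√s)^d → 0` as `s → 0⁺`. -/
theorem tendsto_exp_neg_sq_div_div_sqrt_pow {δ : ℝ} (hδ : 0 < δ) (d : ℕ) :
    Tendsto (fun s : ℝ => Real.exp (-δ ^ 2 / s) / Real.sqrt s ^ d) (𝓝[>] 0) (𝓝 0) := by
  have hδ2 : 0 < δ ^ 2 := by positivity
  -- `u = δ² / s → +∞`
  have hu : Tendsto (fun s : ℝ => δ ^ 2 * s⁻¹) (𝓝[>] 0) atTop :=
    tendsto_inv_nhdsGT_zero.const_mul_atTop hδ2
  have hg := (Real.tendsto_pow_mul_exp_neg_atTop_nhds_zero d).comp hu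
  have hg' : Tendsto (fun s : ℝ => (δ ^ 2)⁻¹ ^ d * ((δ ^ 2 * s⁻¹) ^ d * Real.exp (-(δ ^ 2 * s⁻¹))))
      (𝓝[>] 0) (𝓝 0) := by
    simpa using hg.const_mul ((δ ^ 2)⁻¹ ^ d)
  refine tendsto_of_tendsto_of_tendsto_of_le_of_le' tendsto_const_nhds hg' ?_ ?_
  · filter_upwards [self_mem_nhdsWithin] with s hs
    exact div_nonneg (Real.exp_pos _).le (pow_nonneg (Real.sqrt_nonneg _) _)
  · filter_upwards [Ioo_mem_nhdsGT (zero_lt_one' ℝ)] with s hs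
    have hs0 : 0 < s := hs.1
    have hsq : 0 < Real.sqrt s := Real.sqrt_pos.2 hs0
    have hexp : Real.exp (-δ ^ 2 / s) = Real.exp (-(δ ^ 2 * s⁻¹)) := by
      rw [div_eq_mul_inv, neg_mul]
    rw [hexp, div_le_iff₀ (pow_pos hsq d)]
    -- reduce to `1 ≤ ((δ²)⁻¹ (δ²/s))^d (√s)^d = (√s / s)^d`, i.e. `s ≤ √s` on `(0,1)`.
    have hkey : (1 : ℝ) ≤ (δ ^ 2)⁻¹ ^ d * (δ ^ 2 * s⁻¹) ^ d * Real.sqrt s ^ d := by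
      rw [← mul_pow, ← mul_pow]
      refine one_le_pow₀ ?_
      rw [← mul_assoc, inv_mul_cancel₀ hδ2.ne', one_mul]
      rw [le_inv_mul_iff₀ hs0, mul_one]
      calc s = Real.sqrt s * Real.sqrt s := (Real.mul_self_sqrt hs0.le).symm
        _ ≤ Real.sqrt s * 1 := by
            gcongr
            rw [Real.sqrt_le_one]
            exact hs.2.le
        _ = Real.sqrt s := mul_one _
    calc Real.exp (-(δ ^ 2 * s⁻¹)) = 1 * Real.exp (-(δ ^ 2 * s⁻¹)) := (one_mul _).symm
      _ ≤ ((δ ^ 2)⁻¹ ^ d * (δ ^ 2 * s⁻¹) ^ d * Real.sqrt s ^ d) * Real.exp (-(δ ^ 2 * s⁻¹)) := by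
          gcongr
      _ = (δ ^ 2)⁻¹ ^ d * ((δ ^ 2 * s⁻¹) ^ d * Real.exp (-(δ ^ 2 * s⁻¹))) * Real.sqrt s ^ d := by
          ring


/-- Negligibility of the Gaussian tail against the Gaussian average, at a point where `μ`-balls
have at least polynomial mass `μ (closedBall x r) ≥ c r^d` for small `r`. -/
theorem tendsto_exp_div_lintegral_exp (μ : Measure F) (x : F) {c : ℝ≥0∞} (hc0 : c ≠ 0)
    {d : ℕ} {r₀ : ℝ} (hr₀ : 0 < r₀)
    (hball : ∀ r ∈ Ioo 0 r₀, c * ENNReal.ofReal (r ^ d) ≤ μ (closedBall x r))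
    {δ : ℝ} (hδ : 0 < δ) :
    Tendsto (fun s : ℝ => ENNReal.ofReal (Real.exp (-δ ^ 2 / s)) /
      ∫⁻ z, ENNReal.ofReal (Real.exp (-‖x - z‖ ^ 2 / s)) ∂μ) (𝓝[>] 0) (𝓝 0) := by
  -- the real comparison function
  have hreal : Tendsto (fun s : ℝ => ENNReal.ofReal
      ((Real.exp (-1))⁻¹ * (Real.exp (-δ ^ 2 / s) / Real.sqrt s ^ d)) / c) (𝓝[>] 0) (𝓝 0) := by
    have h1 := (tendsto_exp_neg_sq_div_div_sqrt_pow hδ d).const_mul (Real.exp (-1))⁻¹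
    rw [mul_zero] at h1
    have h2 := ENNReal.tendsto_ofReal h1
    rw [ENNReal.ofReal_zero] at h2
    have h3 := ENNReal.Tendsto.div_const h2 (Or.inr hc0)
    rwa [ENNReal.zero_div] at h3
  refine tendsto_of_tendsto_of_tendsto_of_le_of_le' tendsto_const_nhds hreal
    (Eventually.of_forall fun _ => zero_le) ?_
  filter_upwards [Ioo_mem_nhdsGT (show (0 : ℝ) < r₀ ^ 2 by positivity)] with s hs
  have hs0 : 0 < s := hs.1
  have hsq : Real.sqrt s ∈ Ioo 0 r₀ := by
    refine ⟨Real.sqrt_pos.2 hs0, ?_⟩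
    rw [Real.sqrt_lt' hr₀]
    exact hs.2
  -- lower bound for the denominator
  have hD : ENNReal.ofReal (Real.exp (-1)) * (c * ENNReal.ofReal (Real.sqrt s ^ d)) ≤
      ∫⁻ z, ENNReal.ofReal (Real.exp (-‖x - z‖ ^ 2 / s)) ∂μ :=
    (mul_le_mul' le_rfl (hball _ hsq)).trans (mul_measure_closedBall_sqrt_le_lintegral_exp μ x hs0)
  have hpos : 0 < Real.exp (-1) * Real.sqrt s ^ d := by positivity
  have hb0 : ENNReal.ofReal (Real.exp (-1) * Real.sqrt s ^ d) ≠ 0 := (ENNReal.ofReal_pos.2 hpos).ne'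
  calc ENNReal.ofReal (Real.exp (-δ ^ 2 / s)) / ∫⁻ z, ENNReal.ofReal (Real.exp (-‖x - z‖ ^ 2 / s)) ∂μ
      ≤ ENNReal.ofReal (Real.exp (-δ ^ 2 / s)) /
          (ENNReal.ofReal (Real.exp (-1)) * (c * ENNReal.ofReal (Real.sqrt s ^ d))) :=
        ENNReal.div_le_div_left hD _
    _ = ENNReal.ofReal (Real.exp (-δ ^ 2 / s)) /
          (ENNReal.ofReal (Real.exp (-1) * Real.sqrt s ^ d) * c) := by
        rw [ENNReal.ofReal_mul (Real.exp_pos _).le]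
        ring_nf
    _ = ENNReal.ofReal (Real.exp (-δ ^ 2 / s)) / ENNReal.ofReal (Real.exp (-1) * Real.sqrt s ^ d)
          / c := by
        rw [div_eq_mul_inv, div_eq_mul_inv, div_eq_mul_inv,
          ENNReal.mul_inv (Or.inl hb0) (Or.inl ENNReal.ofReal_ne_top), div_eq_mul_inv, mul_assoc]
    _ = ENNReal.ofReal ((Real.exp (-1))⁻¹ * (Real.exp (-δ ^ 2 / s) / Real.sqrt s ^ d)) / c := by
        rw [← ENNReal.ofReal_div_of_pos hpos]
        congr 2
        field_simp

end Summit.AtomisticToContinuum.HydrodynamicLimit.Theorems.ParityRigidity
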